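import Literature.Probability.LatticeModels.LatticeDirichletEnergy
import Mathlib.Algebra.Order.Chebyshev
import HarnessLib

/-!
# Crux `UVSeamRec` (stmt-QuantumFields-20043), free-field calibration of (RM), file 2/3: the Coulomb energy of a lattice divergence is
# bounded by the `ℓ²`-norm of the flux

Helper file (`--supports stmt-QuantumFields-20043`) of the seam seat `ym-20043-seam-s2` (gen 3); theorems only, no definitions.

WHY.  In the free-field calibration of the registered v5(α) stub `BirthV5A.stub_responseMomentsOdd6 : UV → (RM)` (series
`…GaussianCalibrationKernel` / this file / `…GaussianCalibration`), the variance of a linear statistic `Σ_w f(w) φ_w` of the lattice GFF of `ℤ^d`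
(covariance `latticeGreen/2`) is `½ · greenEnergy S f`; the SEPARATED-FAMILY OPERATOR BOUND for the response carriers of disjoint cubes reduces,
through the interior flux representation of file 1/3, to the present **energy inequality**: for an edge field `m : Fin d → ℤ^d → ℝ` (finitely
supported in `S` together with its forward endpoints) and its lattice divergence `(div m)(w) = Σ_j (m_j(w − e_j) − m_j(w))`,
`greenEnergy S (div m) ≤ 2d · Σ_j Σ_{z ∈ S} m_j(z)²`  (`d ≥ 3`),
i.e. `Var(⟨div m, φ⟩) ≤ d·‖m‖²` — disjointly supported fluxes are orthogonal, which is exactly the `Σ tᵢ²` (almost-orthogonality) structure of the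
sub-Gaussian law in LINEAR sources (LEAD g8 p544631, ceilings-p2 note #54 §2: `ℓ²`, not `ℓ¹`).  Proof in momentum space with the tree's
Fourier toolkit (`LatticeDirichletEnergy`): the symbol of the `j`-difference is `e^{ip_j} − 1`, `|e^{ip_j} − 1|² = 2(1 − cos p_j) ≤ 2ε(p)`,
Cauchy–Schwarz over `j`, and Plancherel.

* §1 shifting finite sums; cosine/sine transforms of a backward `j`-translate; `|f̂_j|² = 2(1 − cos p_j)|m̂_j|²` for `f_j = m_j(· − e_j) − m_j`;
* §2 linearity of the transforms over `j`, the pointwise symbol bound `|Σ_j f̂_j|²/ε ≤ 2d Σ_j |m̂_j|²`, and **`greenEnergy_div_le`**.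

No sorry, standard axioms.  HONEST FRAMING: discrete Fourier analysis; a CALIBRATION tool for one OPEN binder of a CONDITIONAL chain; nothing of
E0′, not a gap, not Clay.  Reference: J. Glimm, A. Jaffe, *Quantum Physics* (1987) §9.5 (lattice Laplacian and its covariance in momentum space).
-/

set_option autoImplicit false

noncomputable section

open MeasureTheory Finset Real
open Literature.Probability.LatticeModels

namespace Summit.QuantumFields.YangMills.Cruxes.UVSeamRec.GaussianCalibration

variable {d : ℕ}

/-! ## §1 Transforms of a backward translate and the symbol of a lattice difference -/

/-- **Shifting a finite sum**: if `g` is supported on sites `z` with `z ∈ S` and `z + v ∈ S`, then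
`Σ_{w ∈ S} g(w − v)·c(w) = Σ_{z ∈ S} g(z)·c(z + v)`. [folklore] -/
theorem sum_shift_mul_eq (S : Finset (Site d)) (g c : Site d → ℝ) (v : Site d)
    (hg : ∀ z, g z ≠ 0 → z ∈ S ∧ z + v ∈ S) :
    ∑ w ∈ S, g (w - v) * c w = ∑ z ∈ S, g z * c (z + v) := by
  classical
  set F : Site d → ℝ := fun w => g (w - v) * c w with hF
  have hFsupp : ∀ w, F w ≠ 0 → w ∈ S ∧ w ∈ S.map (addRightEmbedding v) := by
    intro w hw
    have hgw : g (w - v) ≠ 0 := fun h => hw (by simp [hF, h])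
    obtain ⟨h1, h2⟩ := hg (w - v) hgw
    rw [sub_add_cancel] at h2
    refine ⟨h2, Finset.mem_map.2 ⟨w - v, h1, ?_⟩⟩
    simp
  have hR : ∑ z ∈ S, g z * c (z + v) = ∑ w ∈ S.map (addRightEmbedding v), F w := by
    rw [Finset.sum_map]
    refine Finset.sum_congr rfl fun z _ => ?_
    simp [hF]
  have h1 : ∑ w ∈ S, F w = ∑ w ∈ S ∪ S.map (addRightEmbedding v), F w :=
    Finset.sum_subset Finset.subset_union_left fun w _ hw => by
      by_contra h; exact hw (hFsupp w h).1
  have h2 : ∑ w ∈ S.map (addRightEmbedding v), F w = ∑ w ∈ S ∪ S.map (addRightEmbedding v), F w :=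
    Finset.sum_subset Finset.subset_union_right fun w _ hw => by
      by_contra h; exact hw (hFsupp w h).2
  change ∑ w ∈ S, F w = _
  rw [hR, h1, h2]

/-- Cosine transform of the backward `j`-translate: `Σ_S m(· − e_j) cos(p·w) = cos p_j · m̂_c − sin p_j · m̂_s`. [folklore] -/
theorem cosTransform_shift (S : Finset (Site d)) (m : Site d → ℝ) (j : Fin d)
    (hm : ∀ z, m z ≠ 0 → z ∈ S ∧ z + Pi.single j 1 ∈ S) (p : Fin d → ℝ) :
    cosTransform S (fun w => m (w - Pi.single j 1)) p =
      Real.cos (p j) * cosTransform S m p - Real.sin (p j) * sinTransform S m p := by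
  unfold cosTransform sinTransform
  rw [sum_shift_mul_eq S m (fun w => Real.cos (momPhase p w)) (Pi.single j 1) hm]
  simp_rw [momPhase_add_single, Real.cos_add]
  rw [Finset.mul_sum, Finset.mul_sum, ← Finset.sum_sub_distrib]
  exact Finset.sum_congr rfl fun z _ => by ring

/-- Sine transform of the backward `j`-translate: `Σ_S m(· − e_j) sin(p·w) = sin p_j · m̂_c + cos p_j · m̂_s`. [folklore] -/
theorem sinTransform_shift (S : Finset (Site d)) (m : Site d → ℝ) (j : Fin d)
    (hm : ∀ z, m z ≠ 0 → z ∈ S ∧ z + Pi.single j 1 ∈ S) (p : Fin d → ℝ) :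
    sinTransform S (fun w => m (w - Pi.single j 1)) p =
      Real.sin (p j) * cosTransform S m p + Real.cos (p j) * sinTransform S m p := by
  unfold cosTransform sinTransform
  rw [sum_shift_mul_eq S m (fun w => Real.sin (momPhase p w)) (Pi.single j 1) hm]
  simp_rw [momPhase_add_single, Real.sin_add]
  rw [Finset.mul_sum, Finset.mul_sum, ← Finset.sum_add_distrib]
  exact Finset.sum_congr rfl fun z _ => by ring

/-- The cosine transform is linear: transform of a pointwise difference. [folklore] -/
theorem cosTransform_sub (S : Finset (Site d)) (g h : Site d → ℝ) (p : Fin d → ℝ) :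
    cosTransform S (fun w => g w - h w) p = cosTransform S g p - cosTransform S h p := by
  unfold cosTransform
  rw [← Finset.sum_sub_distrib]
  exact Finset.sum_congr rfl fun z _ => by ring

/-- The sine transform is linear: transform of a pointwise difference. [folklore] -/
theorem sinTransform_sub (S : Finset (Site d)) (g h : Site d → ℝ) (p : Fin d → ℝ) :
    sinTransform S (fun w => g w - h w) p = sinTransform S g p - sinTransform S h p := by
  unfold sinTransform
  rw [← Finset.sum_sub_distrib]
  exact Finset.sum_congr rfl fun z _ => by ring

/-- The cosine transform of a finite sum of functions. [folklore] -/
theorem cosTransform_finset_sum {ι : Type*} (T : Finset ι) (S : Finset (Site d)) (g : ι → Site d → ℝ) (p : Fin d → ℝ) :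
    cosTransform S (fun w => ∑ j ∈ T, g j w) p = ∑ j ∈ T, cosTransform S (g j) p := by
  unfold cosTransform
  simp_rw [Finset.sum_mul]
  rw [Finset.sum_comm]

/-- The sine transform of a finite sum of functions. [folklore] -/
theorem sinTransform_finset_sum {ι : Type*} (T : Finset ι) (S : Finset (Site d)) (g : ι → Site d → ℝ) (p : Fin d → ℝ) :
    sinTransform S (fun w => ∑ j ∈ T, g j w) p = ∑ j ∈ T, sinTransform S (g j) p := by
  unfold sinTransform
  simp_rw [Finset.sum_mul]
  rw [Finset.sum_comm]

/-- **The symbol of a lattice difference**: for `f_j = m(· − e_j) − m` (the divergence of a flux along the `j`-edges),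
`|f̂_j(p)|² = 2(1 − cos p_j) · |m̂(p)|²`. [cite: GlimmJaffe1987, §9.5 (9.5.8)–(9.5.10)] -/
theorem fourierPair_shift_sub_self (S : Finset (Site d)) (m : Site d → ℝ) (j : Fin d)
    (hm : ∀ z, m z ≠ 0 → z ∈ S ∧ z + Pi.single j 1 ∈ S) (p : Fin d → ℝ) :
    fourierPair S (fun w => m (w - Pi.single j 1) - m w) (fun w => m (w - Pi.single j 1) - m w) p =
      2 * (1 - Real.cos (p j)) * fourierPair S m m p := by
  rw [fourierPair_self, fourierPair_self, cosTransform_sub, sinTransform_sub, cosTransform_shift S m j hm p,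
    sinTransform_shift S m j hm p]
  have h := Real.sin_sq_add_cos_sq (p j)
  set c := Real.cos (p j)
  set s := Real.sin (p j)
  set C := cosTransform S m p
  set Sn := sinTransform S m p
  have e1 : (c * C - s * Sn - C) ^ 2 + (s * C + c * Sn - Sn) ^ 2 = ((c - 1) ^ 2 + s ^ 2) * (C ^ 2 + Sn ^ 2) := by ring
  have e2 : (c - 1) ^ 2 + s ^ 2 = 2 * (1 - c) := by nlinarith [h]
  rw [e1, e2]

/-! ## §2 The energy inequality for a lattice divergence -/

/-- **Pointwise symbol bound**: for an edge field `m` and `f = Σ_j (m_j(· − e_j) − m_j)`,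
`|f̂(p)|² / ε(p) ≤ 2d · Σ_j |m̂_j(p)|²` (Cauchy–Schwarz over `j` and `1 − cos p_j ≤ ε(p)`; at `ε(p) = 0` both sides vanish/are nonneg). [folklore] -/
theorem fourierPair_div_self_div_dispersion_le (S : Finset (Site d)) (m : Fin d → Site d → ℝ)
    (hm : ∀ j z, m j z ≠ 0 → z ∈ S ∧ z + Pi.single j 1 ∈ S) (p : Fin d → ℝ) :
    fourierPair S (fun w => ∑ j, (m j (w - Pi.single j 1) - m j w)) (fun w => ∑ j, (m j (w - Pi.single j 1) - m j w)) p /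
        dispersion p ≤ 2 * d * ∑ j, fourierPair S (m j) (m j) p := by
  set f : Fin d → Site d → ℝ := fun j w => m j (w - Pi.single j 1) - m j w with hf
  have hFP : ∀ j, fourierPair S (f j) (f j) p = 2 * (1 - Real.cos (p j)) * fourierPair S (m j) (m j) p :=
    fun j => fourierPair_shift_sub_self S (m j) j (hm j) p
  have hnum : fourierPair S (fun w => ∑ j, f j w) (fun w => ∑ j, f j w) p ≤ d * ∑ j, fourierPair S (f j) (f j) p := by
    rw [fourierPair_self, cosTransform_finset_sum, sinTransform_finset_sum]
    have h1 := sq_sum_le_card_mul_sum_sq (s := (Finset.univ : Finset (Fin d))) (f := fun j => cosTransform S (f j) p)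
    have h2 := sq_sum_le_card_mul_sum_sq (s := (Finset.univ : Finset (Fin d))) (f := fun j => sinTransform S (f j) p)
    rw [Finset.card_univ, Fintype.card_fin] at h1 h2
    simp_rw [fourierPair_self]
    rw [Finset.sum_add_distrib, mul_add]
    exact add_le_add h1 h2
  have hFP0 : ∀ j, 0 ≤ fourierPair S (m j) (m j) p := fun j => fourierPair_self_nonneg S (m j) p
  have hdisp0 : 0 ≤ dispersion p := dispersion_nonneg p
  rcases hdisp0.eq_or_lt with h0 | hpos
  · rw [← h0, div_zero]
    exact mul_nonneg (by positivity) (Finset.sum_nonneg fun j _ => hFP0 j)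
  · rw [div_le_iff₀ hpos]
    refine hnum.trans ?_
    simp_rw [hFP]
    have hle : ∀ j, 2 * (1 - Real.cos (p j)) * fourierPair S (m j) (m j) p ≤ 2 * dispersion p * fourierPair S (m j) (m j) p := by
      intro j
      refine mul_le_mul_of_nonneg_right (mul_le_mul_of_nonneg_left ?_ zero_le_two) (hFP0 j)
      unfold dispersion
      exact Finset.single_le_sum (f := fun i => 1 - Real.cos (p i)) (fun i _ => sub_nonneg.2 (Real.cos_le_one _))
        (Finset.mem_univ j)
    calc (d : ℝ) * ∑ j, 2 * (1 - Real.cos (p j)) * fourierPair S (m j) (m j) p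
        ≤ d * ∑ j, 2 * dispersion p * fourierPair S (m j) (m j) p :=
          mul_le_mul_of_nonneg_left (Finset.sum_le_sum fun j _ => hle j) (by positivity)
      _ = 2 * d * (∑ j, fourierPair S (m j) (m j) p) * dispersion p := by rw [← Finset.mul_sum]; ring

/-- **Energy inequality for a lattice divergence** (`d ≥ 3`): for an edge field `m : Fin d → ℤ^d → ℝ` supported, together with its
forward endpoints, in the finite set `S`, the Coulomb energy of its divergence `(div m)(w) = Σ_j (m_j(w − e_j) − m_j(w))` obeys
`greenEnergy S (div m) ≤ 2d · Σ_j Σ_{z ∈ S} m_j(z)²`; for the lattice GFF (covariance `latticeGreen/2`) this reads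
`Var(Σ_j Σ_z m_j(z)(φ_{z+e_j} − φ_z)) ≤ d · ‖m‖²_{ℓ²}` — the flux form of the Dirichlet principle. [cite: GlimmJaffe1987, §9.5 Prop. 9.5.2] -/
theorem greenEnergy_div_le (hd : 3 ≤ d) (S : Finset (Site d)) (m : Fin d → Site d → ℝ)
    (hm : ∀ j z, m j z ≠ 0 → z ∈ S ∧ z + Pi.single j 1 ∈ S) :
    greenEnergy S (fun w => ∑ j, (m j (w - Pi.single j 1) - m j w)) ≤ 2 * d * ∑ j, ∑ z ∈ S, (m j z) ^ 2 := by
  rw [greenEnergy_eq_integral_fourierPair d hd]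
  have hP : ∀ j, ∑ z ∈ S, (m j z) ^ 2 = (∫ p in brillouin d, fourierPair S (m j) (m j) p) / (2 * π) ^ d :=
    fun j => sum_sq_eq_integral_fourierPair S (m j)
  simp_rw [hP]
  rw [← Finset.sum_div, mul_div_assoc', div_le_div_iff_of_pos_right (by positivity),
    ← integral_finsetSum _ fun j _ => (integrableOn_brillouin_of_continuous (continuous_fourierPair S (m j) (m j))),
    ← integral_const_mul]
  refine setIntegral_mono_on (integrableOn_fourierPair_div_dispersion d hd S _ _)
    ((integrableOn_brillouin_of_continuous (continuous_finsetSum _ fun j _ => continuous_fourierPair S (m j) (m j))).const_mul _)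
    (measurableSet_brillouin d) fun p _ => ?_
  exact fourierPair_div_self_div_dispersion_le S m hm p

end Summit.QuantumFields.YangMills.Cruxes.UVSeamRec.GaussianCalibration

end
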